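import Literature.AlgebraicGeometry.HodgeTheory.FermatSurfaceModelRatio
import HarnessLib

/-!
# Holomorphic models of the Fermat surface: the `μₘ⁴`-orbits of the affine coordinates and the invariant quotient function

Family `hodge`, layer `Literature/AlgebraicGeometry/HodgeTheory`. PROOF FILE (theorems only; no
definition, no named fact — D-0026), continuing `FermatSurfaceModelRatio` on the path of the
analytic leaf `hmodel` of `AokiShioda1983_eigenline_le_neronSeveri_holds_of_modelEigenforms`.
Data: a model `ψ : M → ℙ(ℂ⁴)` of the Fermat surface `V(Σ xᵢᵐ)` and holomorphic maps
`Φ_a : M → M` (`a ∈ μₘ⁴`) over `[x] ↦ [a • x]`. On `M₀ = ψ⁻¹{x₀ ≠ 0}` the affine coordinates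
are `y_j = (Z̃₀ ·)_j = x_j/x₀` (`y₀ = 1`), with `1 + y₁ᵐ + y₂ᵐ + y₃ᵐ = 0`; the quotient of `M₀`
by `μₘ³ = {a₀ = 1}` is the affine plane `{u₀ = 1} ⊂ {Σ uᵢ = 0}`, `u_j = y_jᵐ`. Proved here:

* `sum_projLift_pow_eq_zero` — `Σ_j (Z̃_k x)_jᵐ = 0` on `M_k`;
* `exists_projLift_eq` — every normalised solution `v` (`v_k = 1`, `Σ v_jᵐ = 0`) is `Z̃_k x`
  for some `x ∈ M_k` (`ψ` is onto `V(F₀)`);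
* `projLift_zero_symm` — `y_j(Φ_a x) = (a_j/a₀) y_j(x)`; `symm_apply_eq_self_of` — `Φ_a` fixes the
  points whose non-zero coordinates sit where `a_j = a₀`;
* `exists_symm_apply_eq` — **the fibres of `y ↦ (y_jᵐ)_j` on `{all y_j ≠ 0}` are `μₘ³`-orbits**:
  if `y_j(x)ᵐ = y_j(x')ᵐ` for all `j` and no `y_j(x)` vanishes, then `x' = Φ_a x` for some
  `a ∈ μₘ⁴` with `a₀ = 1` (`a_j = y_j(x')/y_j(x)`, `ψ` injective);
* `prod_mul_prod_pow_pred_eq`, `prod_div_pow_eq_prod_pow` — the character bookkeeping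
  `∏_j (a_j/a₀) · ∏_j (a_j/a₀)^{b_j − 1} = ∏_j a_j^{b_j}` when `b_j ≥ 1` (`j ≠ 0`) and
  `a₀^{Σ b_j} = 1`;
* `fermatQuotientFn_symm` — hence **the quotient function `F = f₀ / ∏_j y_j^{b_j − 1}` of a
  `χ_β`-eigenform (`b_j = ⟨β_j⟩`) is `μₘ⁴`-INVARIANT on `M₀`** (`fermatRatio_symm`:
  `f₀(Φ_a x) ∏ a_j/a₀ = χ_β(a) f₀(x)`), so that it descends to the `u`-plane;
  `fermatQuotientFn_eq_of_pow_eq` — equivalently `F x' = F x` along the fibres.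

In print (Shioda 1979 §1): `Xⁿₘ → ℙⁿ`, `[x] ↦ [xᵢᵐ]`, is the quotient by `μₘⁿ⁺²/diagonal`.

## References

* [Shioda1979HodgeFermat] T. Shioda, The Hodge conjecture for Fermat varieties, Math. Ann. 245
  (1979) 175–184, §1.
* [ShiodaKatsura1979] T. Shioda, T. Katsura, On Fermat varieties, Tôhoku Math. J. 31 (1979)
  97–115, §1 (the quotient `Xⁿₘ → ℙⁿ`).
-/

noncomputable section

open scoped Manifold ContDiff Topology LinearAlgebra.Projectivization
open Set Filter Projectivization

namespace Literature.AlgebraicGeometry.HodgeTheory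

open Literature.AlgebraicGeometry.Motives Literature.NumberTheory.Transcendental
  Literature.Geometry.Kaehler

/-! ### Character bookkeeping -/

section Characters

/-- `∏_j δ_j · ∏_j δ_j^{b_j − 1} = ∏_j δ_j^{b_j}` when `δ₀ = 1` and `b_j ≥ 1` for `j ≠ 0`.
[folklore] -/
theorem prod_mul_prod_pow_pred_eq {δ : Fin (2 + 2) → ℂ} (hδ : δ 0 = 1) {b : Fin (2 + 2) → ℕ}
    (hb : ∀ j, j ≠ 0 → 1 ≤ b j) : (∏ j, δ j) * ∏ j, δ j ^ (b j - 1) = ∏ j, δ j ^ b j := by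
  rw [← Finset.prod_mul_distrib]
  refine Finset.prod_congr rfl fun j _ ↦ ?_
  by_cases hj : j = 0
  · subst hj; simp [hδ]
  · rw [mul_comm, ← pow_succ, Nat.sub_add_cancel (hb j hj)]

/-- `∏_j (a_j/a₀)^{b_j} = ∏_j a_j^{b_j}` when `a₀^{Σ b_j} = 1`. [folklore] -/
theorem prod_div_pow_eq_prod_pow (a : Fin (2 + 2) → ℂ) (b : Fin (2 + 2) → ℕ)
    (hsum : a 0 ^ (∑ j, b j) = 1) : ∏ j, (a j / a 0) ^ b j = ∏ j, a j ^ b j := by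
  simp_rw [div_pow]
  rw [Finset.prod_div_distrib, Finset.prod_pow_eq_pow_sum, hsum, div_one]

/-- **The character of `μₘ⁴` carried by `f₀ / ∏_j y_j^{b_j − 1}` is trivial**: with
`δ_j = a_j/a₀`, `∏_j δ_j · ∏_j δ_j^{b_j − 1} = ∏_j a_j^{b_j} = χ_β(a)` whenever `b_j ≥ 1` for
`j ≠ 0` and `a₀^{Σ b_j} = 1` (i.e. `Σ β_j = 0` in `ℤ/m`). [cite: Shioda1979HodgeFermat, §1 (1.7)] -/
theorem prod_div_mul_prod_div_pow_pred_eq (a : Fin (2 + 2) → ℂ) (h0 : a 0 ≠ 0) {b : Fin (2 + 2) → ℕ}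
    (hb : ∀ j, j ≠ 0 → 1 ≤ b j) (hsum : a 0 ^ (∑ j, b j) = 1) :
    (∏ j, a j / a 0) * ∏ j, (a j / a 0) ^ (b j - 1) = ∏ j, a j ^ b j := by
  rw [prod_mul_prod_pow_pred_eq (δ := fun j ↦ a j / a 0) (div_self h0) hb]
  exact prod_div_pow_eq_prod_pow a b hsum

end Characters

section Surface

variable {m : ℕ} {E : Type*} [NormedAddCommGroup E] [NormedSpace ℂ E]
  {M : Type*} [TopologicalSpace M] [ChartedSpace E M] {ψ : M → ℙ ℂ (Fin (2 + 2) → ℂ)}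

/-! ### The affine coordinates -/

omit [TopologicalSpace M] [ChartedSpace E M] in
/-- `Σ_j (Z̃_k x)_jᵐ = 0` on `M_k`: the lift lies on the cone of the Fermat form.
[cite: Shioda1979HodgeFermat, §1] -/
theorem sum_projLift_pow_eq_zero (hrange : Set.range ψ ⊆ projZeroLocus {fermatPolynomial ℂ 2 m})
    {k : Fin (2 + 2)} {x : M} (hx : x ∈ liftDomain ψ k) : ∑ j, projLift ψ k x j ^ m = 0 := by
  have h := eval_projLift_eq_zero ψ (isHomogeneous_fermatPolynomial 2 m) hrange hx
  simpa [fermatPolynomial, map_sum] using h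

omit [TopologicalSpace M] [ChartedSpace E M] in
/-- **Every normalised solution is a lift**: if `v_k = 1` and `Σ v_jᵐ = 0` then `v = Z̃_k x` for
some `x ∈ M_k` (`ψ` is onto `V(F₀)`). [cite: Shioda1979HodgeFermat, §1] -/
theorem exists_projLift_eq (hrange : Set.range ψ = projZeroLocus {fermatPolynomial ℂ 2 m})
    {k : Fin (2 + 2)} {v : Fin (2 + 2) → ℂ} (hvk : v k = 1) (hv : ∑ j, v j ^ m = 0) :
    ∃ x, x ∈ liftDomain ψ k ∧ projLift ψ k x = v := by
  have hv0 : v ≠ 0 := fun h ↦ by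
    have := congrFun h k
    rw [hvk] at this
    exact one_ne_zero this
  have hmem : Projectivization.mk ℂ v hv0 ∈ projZeroLocus {fermatPolynomial ℂ 2 m} := by
    by_cases hm : fermatPolynomial ℂ 2 m = 0
    · intro G hG
      rw [Set.mem_singleton_iff] at hG
      subst hG
      simp [hm]
    have hS : ∀ G ∈ ({fermatPolynomial ℂ 2 m} : Set (MvPolynomial (Fin (2 + 2)) ℂ)),
        G.IsHomogeneous G.totalDegree := by
      rintro G rfl
      rw [(isHomogeneous_fermatPolynomial 2 m).totalDegree hm]
      exact isHomogeneous_fermatPolynomial 2 m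
    refine (mem_projZeroLocus_mk_iff hS _ _).mpr ?_
    rintro G rfl
    simpa [fermatPolynomial, map_sum] using hv
  rw [← hrange] at hmem
  obtain ⟨x, hx⟩ := hmem
  exact ⟨x, projLift_eq_of_mk_eq ψ hv0 hx.symm hvk⟩

/-! ### The symmetries on the affine coordinates -/

variable {Φ : fermatGroup 2 m → M → M}
  (hΦ : ∀ (a : fermatGroup 2 m) (x : M), ψ (Φ a x) =
    Projectivization.mk ℂ ((a : Fin (2 + 2) → ℂˣ) • (ψ x).rep)
      ((smul_ne_zero_iff_ne (a : Fin (2 + 2) → ℂˣ)).mpr (Projectivization.rep_nonzero _)))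

omit [TopologicalSpace M] [ChartedSpace E M] in
include hΦ in
/-- `y_j(Φ_a x) = (a_j/a₀) · y_j(x)` on `M₀` (`projLift_symm`). [cite: Shioda1979HodgeFermat, §1] -/
theorem projLift_zero_symm (a : fermatGroup 2 m) {k : Fin (2 + 2)} {x : M} (hx : x ∈ liftDomain ψ k)
    (j : Fin (2 + 2)) :
    projLift ψ k (Φ a x) j =
      ((a : Fin (2 + 2) → ℂˣ) j : ℂ) / ((a : Fin (2 + 2) → ℂˣ) k : ℂ) * projLift ψ k x j := by
  have h := (projLift_symm (hΦ a) hx).2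
  exact congrFun h j

omit [TopologicalSpace M] [ChartedSpace E M] in
include hΦ in
/-- **`Φ_a` fixes the points of `M_k` at which `a_j = a_k` wherever `y_j ≠ 0`** (e.g. the
points of `{y_i = 0}` under `a = (1, …, ζ, …, 1)`, `ζ` in slot `i`): both have the same lift.
[cite: Shioda1979HodgeFermat, §1] -/
theorem symm_apply_eq_self_of (hinj : Function.Injective ψ) (a : fermatGroup 2 m) {k : Fin (2 + 2)}
    {x : M} (hx : x ∈ liftDomain ψ k)
    (ha : ∀ j, projLift ψ k x j ≠ 0 → (a : Fin (2 + 2) → ℂˣ) j = (a : Fin (2 + 2) → ℂˣ) k) :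
    Φ a x = x := by
  have hΦx := (projLift_symm (hΦ a) hx).1
  have hlift : projLift ψ k (Φ a x) = projLift ψ k x := by
    funext j
    rw [projLift_zero_symm hΦ a hx j]
    by_cases hj : projLift ψ k x j = 0
    · rw [hj, mul_zero]
    · rw [ha j hj, div_self ((a : Fin (2 + 2) → ℂˣ) k).ne_zero, one_mul]
  apply hinj
  rw [← mk_projLift ψ hΦx, ← mk_projLift ψ hx]
  exact (Projectivization.mk_eq_mk_iff _ _ _ _ _).mpr ⟨1, by rw [one_smul, hlift]⟩

omit [TopologicalSpace M] [ChartedSpace E M] in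
include hΦ in
/-- **The fibres of `x ↦ (y_j(x)ᵐ)_j` on `{all y_j ≠ 0} ⊂ M₀` are orbits of `μₘ³ = {a₀ = 1}`.**
If `x, x' ∈ M₀` have `y_j(x)ᵐ = y_j(x')ᵐ` for all `j` and no `y_j(x)` vanishes, then `x' = Φ_a x`
for the element `a ∈ μₘ⁴` with `a₀ = 1`, `a_j = y_j(x')/y_j(x)`: the two points have the same lift
`Z̃₀`, hence the same image under the injective `ψ`. In print: `X → ℙ`, `[x] ↦ [xᵢᵐ]`, is the
quotient by `μₘⁿ⁺²` (Shioda–Katsura §1). [cite: ShiodaKatsura1979, §1] [cite: Shioda1979HodgeFermat, §1] -/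
theorem exists_symm_apply_eq [NeZero m] (hinj : Function.Injective ψ) {x x' : M} (hx : x ∈ liftDomain ψ 0)
    (hx' : x' ∈ liftDomain ψ 0) (hpow : ∀ j, projLift ψ 0 x j ^ m = projLift ψ 0 x' j ^ m)
    (hne : ∀ j, projLift ψ 0 x j ≠ 0) :
    ∃ a : fermatGroup 2 m, (a : Fin (2 + 2) → ℂˣ) 0 = 1 ∧ Φ a x = x' := by
  set y := projLift ψ 0 x with hy
  set y' := projLift ψ 0 x' with hy'
  have hm : m ≠ 0 := NeZero.ne m
  have hne' : ∀ j, y' j ≠ 0 := fun j h0 ↦ by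
    have := hpow j
    rw [h0, zero_pow hm] at this
    exact hne j ((pow_eq_zero_iff hm).mp this)
  -- the element `a`
  set av : Fin (2 + 2) → ℂˣ := fun j ↦ Units.mk0 (y' j / y j) (div_ne_zero (hne' j) (hne j))
    with hav
  have hav_mem : av ∈ fermatGroup 2 m := by
    rw [mem_fermatGroup_iff]
    intro j
    ext
    rw [Units.val_pow_eq_pow_val, Units.val_one, hav, Units.val_mk0, div_pow, ← hpow j,
      div_self (pow_ne_zero _ (hne j))]
  refine ⟨⟨av, hav_mem⟩, ?_, ?_⟩
  · ext
    simp [hav, hy, hy', projLift_apply_self]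
  · -- same lift, hence same point
    have hΦx := (projLift_symm (hΦ ⟨av, hav_mem⟩) hx).1
    have hlift : projLift ψ 0 (Φ ⟨av, hav_mem⟩ x) = y' := by
      funext j
      rw [projLift_zero_symm hΦ ⟨av, hav_mem⟩ hx j]
      change (av j : ℂ) / (av 0 : ℂ) * y j = y' j
      simp only [hav, Units.val_mk0, hy, hy', projLift_apply_self, div_one]
      exact div_mul_cancel₀ _ (hne j)
    apply hinj
    rw [← mk_projLift ψ hΦx, ← mk_projLift ψ hx']
    exact (Projectivization.mk_eq_mk_iff _ _ _ _ _).mpr ⟨1, by rw [one_smul, hlift]⟩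

/-! ### The invariant quotient function -/

omit [TopologicalSpace M] [ChartedSpace E M] in
include hΦ in
/-- **The quotient function `F = f₀ / ∏_j y_j^{b_j − 1}` of a `χ_β`-eigenform is
`μₘ⁴`-invariant on `M₀`.** Here `b_j = ⟨β_j⟩` with `b_j ≥ 1` for `j ≠ 0` and `Σ_j b_j ≡ 0 (mod m)`
(`a₀^{Σ b} = 1` for all `a`), and `f₀` satisfies the transformation law of `fermatRatio_symm`:
`f₀(Φ_a x) ∏_j (a_j/a₀) = χ_β(a) f₀(x)`. Then `F(Φ_a x) = F(x)`:
`F(Φ_a x) = χ f₀ / (∏ δ_j · ∏ (δ_j y_j)^{b_j−1}) = χ f₀ / (χ ∏ y_j^{b_j−1})`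
(`prod_div_mul_prod_div_pow_pred_eq`). [cite: Shioda1979HodgeFermat, §1 (1.7)] -/
theorem fermatQuotientFn_symm {β : Fin (2 + 2) → ZMod m} (hβ : ∀ j, j ≠ 0 → 1 ≤ (β j).val)
    (hsum : ∀ a : fermatGroup 2 m, (((a : Fin (2 + 2) → ℂˣ) 0 : ℂˣ) : ℂ) ^ (∑ j, (β j).val) = 1)
    {f₀ : M → ℂ}
    (hf₀ : ∀ (a : fermatGroup 2 m) (x : M), x ∈ liftDomain ψ 0 →
      f₀ (Φ a x) * ∏ j, ((((a : Fin (2 + 2) → ℂˣ) j : ℂˣ) : ℂ) / (((a : Fin (2 + 2) → ℂˣ) 0 : ℂˣ) : ℂ)) =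
        ((fermatCharacter m β a : ℂˣ) : ℂ) * f₀ x)
    {Fq : M → ℂ} (hFq : ∀ x, Fq x = f₀ x / ∏ j, projLift ψ 0 x j ^ ((β j).val - 1))
    (a : fermatGroup 2 m) {x : M} (hx : x ∈ liftDomain ψ 0) : Fq (Φ a x) = Fq x := by
  set av : Fin (2 + 2) → ℂ := fun j ↦ (((a : Fin (2 + 2) → ℂˣ) j : ℂˣ) : ℂ) with hav
  have h0 : av 0 ≠ 0 := ((a : Fin (2 + 2) → ℂˣ) 0).ne_zero
  have hχ : ((fermatCharacter m β a : ℂˣ) : ℂ) = ∏ j, av j ^ (β j).val := by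
    rw [fermatCharacter_apply]; push_cast; rfl
  have hprod : (∏ j, av j / av 0) ≠ 0 :=
    Finset.prod_ne_zero_iff.mpr fun j _ ↦ div_ne_zero ((a : Fin (2 + 2) → ℂˣ) j).ne_zero h0
  have hχ0 : ((fermatCharacter m β a : ℂˣ) : ℂ) ≠ 0 := (fermatCharacter m β a).ne_zero
  have key := prod_div_mul_prod_div_pow_pred_eq av h0 hβ (hsum a)
  rw [← hχ] at key
  -- `f₀ (Φ a x) = χ f₀ x / ∏ δ`
  have hf : f₀ (Φ a x) = ((fermatCharacter m β a : ℂˣ) : ℂ) * f₀ x / ∏ j, av j / av 0 := by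
    rw [eq_div_iff hprod]
    exact hf₀ a x hx
  -- the denominators
  have hden : ∏ j, projLift ψ 0 (Φ a x) j ^ ((β j).val - 1) =
      (∏ j, (av j / av 0) ^ ((β j).val - 1)) * ∏ j, projLift ψ 0 x j ^ ((β j).val - 1) := by
    rw [← Finset.prod_mul_distrib]
    refine Finset.prod_congr rfl fun j _ ↦ ?_
    rw [projLift_zero_symm hΦ a hx j, mul_pow]
  rw [hFq, hFq, hden, hf]
  rw [div_div, ← mul_assoc, key]
  rw [mul_div_mul_left _ _ hχ0]

omit [TopologicalSpace M] [ChartedSpace E M] in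
include hΦ in
/-- **`F` is constant along the fibres of `x ↦ (y_jᵐ)_j`** (over points with no vanishing
coordinate): `F x' = F x` whenever `y_j(x)ᵐ = y_j(x')ᵐ` for all `j` and all `y_j(x) ≠ 0`
(`exists_symm_apply_eq` + `fermatQuotientFn_symm`). [cite: Shioda1979HodgeFermat, §1 (1.7)] -/
theorem fermatQuotientFn_eq_of_pow_eq [NeZero m] (hinj : Function.Injective ψ) {β : Fin (2 + 2) → ZMod m}
    (hβ : ∀ j, j ≠ 0 → 1 ≤ (β j).val)
    (hsum : ∀ a : fermatGroup 2 m, (((a : Fin (2 + 2) → ℂˣ) 0 : ℂˣ) : ℂ) ^ (∑ j, (β j).val) = 1)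
    {f₀ : M → ℂ}
    (hf₀ : ∀ (a : fermatGroup 2 m) (x : M), x ∈ liftDomain ψ 0 →
      f₀ (Φ a x) * ∏ j, ((((a : Fin (2 + 2) → ℂˣ) j : ℂˣ) : ℂ) / (((a : Fin (2 + 2) → ℂˣ) 0 : ℂˣ) : ℂ)) =
        ((fermatCharacter m β a : ℂˣ) : ℂ) * f₀ x)
    {Fq : M → ℂ} (hFq : ∀ x, Fq x = f₀ x / ∏ j, projLift ψ 0 x j ^ ((β j).val - 1))
    {x x' : M} (hx : x ∈ liftDomain ψ 0) (hx' : x' ∈ liftDomain ψ 0)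
    (hpow : ∀ j, projLift ψ 0 x j ^ m = projLift ψ 0 x' j ^ m) (hne : ∀ j, projLift ψ 0 x j ≠ 0) :
    Fq x' = Fq x := by
  obtain ⟨a, -, rfl⟩ := exists_symm_apply_eq hΦ hinj hx hx' hpow hne
  exact fermatQuotientFn_symm hΦ hβ hsum hf₀ hFq a hx

end Surface

end Literature.AlgebraicGeometry.HodgeTheory

end
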